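import Summits.CriticalPhenomena.PercolationContinuityZ3.Theorems.PercNearOneGluingNoHeavyLowerTailCoSunflowerRows
import Literature.Probability.Percolation.ProdBernoulliRusso
import Literature.Probability.LatticeModels.RandomClusterFKG
import Mathlib.Tactic.Ring
import Mathlib.Tactic.Linarith
import HarnessLib

/-!
# `NoHeavyLowerTail` (stmt-CriticalPhenomena-4575) — gluing two terminals = a weight-one edge, and the
# quotient reductions of the open increasing E3GRP sunflower rows: `TIncRow → BetaRow`

Support file (prover prim-e3grp-switch-3, E3GRP switching line; `--supports stmt-CriticalPhenomena-4575`).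
No definitions, no named facts, no sorries.

**The device.**  For `μ_w = prodBernoulli w` on `Set (Sym2 V)` and a pair `e`, the law `μ_{w[e ↦ 1]}` (the edge
`e` forced open, i.e. its two endpoints GLUED) is the image of `μ_w` under `ω ↦ insert e ω`:
`μ_{w[e↦1]}(B) = μ_w {ω | insert e ω ∈ B}` (`prodBernoulli_real_update_one`; from the powerset expansion
`RussoPath.prodBernoulli_real_eq_sum_powerset`), hence `E₃` transfers (`sahiE3_update_one`).  Reachability after
adding the edge `s(c,y)` is `reachable_sup_edge` (tree `reachable_sup_edge_imp` + the trivial converse), so every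
group-connection event of the glued graph is a group-connection event of the original one with `c, y` in one group.

**Consequence.**  `betaRow_of_tIncRow : TIncRow → BetaRow`: the harness row
`β = E₃(lnk[a|bcy], lnk[ab|cy], lnk[acy|b])` on a weighted graph `G` IS the three-terminal row
`T_inc = E₃(N_a, N_b, N_c)` on `G` with the pair `{c,y}` forced open (terminals `a, b, c`).  So the open increasing
sunflower class `{β, γ, r4, r5, r6}` has the two generators `TIncRow`, `GammaRow` (`r5 = T_inc` with `{o,b}` and
`{a₁,a₂}` glued, `r6 = γ` with `{a₂,b}` glued, `r4 = γ`, by the same device).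
-/

noncomputable section

namespace Summit.CriticalPhenomena.PercolationContinuityZ3.Theorems

open MeasureTheory
open Literature.Probability.LatticeModels
open Literature.Probability.Percolation

namespace CoSunflowerGlue

/-! ### Weight-one coordinate = image under `insert` -/

section Weights

variable {ι : Type*} [Fintype ι] [DecidableEq ι]

/-- An event pulled back under `insert e` does not depend on the coordinate `e`. [folklore] -/
theorem determinedBy_preimage_insert (B : Set (Set ι)) (e : ι) :
    DeterminedBy {ω : Set ι | insert e ω ∈ B} (↑(Finset.univ.erase e) : Set ι) := by
  rw [determinedBy_iff]
  intro ω ω' h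
  have key : insert e ω = insert e ω' := by
    ext i
    by_cases hi : i = e
    · subst hi; simp
    · have hiK : i ∈ (↑(Finset.univ.erase e) : Set ι) := by simp [hi]
      have h1 : i ∈ ω ∩ ↑(Finset.univ.erase e) ↔ i ∈ ω' ∩ ↑(Finset.univ.erase e) := by rw [h]
      simp only [Set.mem_inter_iff, hiK, and_true] at h1
      simp [hi, h1]
  simp only [Set.mem_setOf_eq, key]

/-- Changing the weight of a coordinate the event does not depend on does not change its probability.
[folklore] -/
theorem prodBernoulli_real_update_of_determinedBy (w : ι → unitInterval) (e : ι) (x : unitInterval)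
    {B : Set (Set ι)} (hB : DeterminedBy B (↑(Finset.univ.erase e) : Set ι)) :
    (prodBernoulli (Function.update w e x)).real B = (prodBernoulli w).real B := by
  classical
  rw [RussoPath.prodBernoulli_real_eq_sum_powerset hB, RussoPath.prodBernoulli_real_eq_sum_powerset hB]
  refine Finset.sum_congr rfl fun S _ => ?_
  split_ifs with hS
  · refine Finset.prod_congr rfl fun i hi => ?_
    have hie : i ≠ e := (Finset.mem_erase.1 hi).1
    rw [Function.update_of_ne hie]
  · rfl

omit [DecidableEq ι] in
/-- Under a weight-one coordinate `e`, every event coincides a.s. with its pull-back under `insert e`.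
[folklore] -/
theorem prodBernoulli_real_eq_inter_mem (w : ι → unitInterval) (e : ι) (he : w e = 1) (B : Set (Set ι)) :
    (prodBernoulli w).real B = (prodBernoulli w).real (B ∩ {ω | e ∈ ω}) := by
  have h0 : (prodBernoulli w).real {ω : Set ι | e ∉ ω} = 0 := by
    rw [prodBernoulli_real_setOf_notMem, he]; simp
  have hsplit := measureReal_inter_add_sdiff₀ (μ := prodBernoulli w) (s := B)
    (t := {ω : Set ι | e ∈ ω}) MeasurableSet.of_discrete.nullMeasurableSet
  have hle : (prodBernoulli w).real (B \ {ω : Set ι | e ∈ ω}) ≤ 0 := by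
    calc (prodBernoulli w).real (B \ {ω : Set ι | e ∈ ω})
        ≤ (prodBernoulli w).real {ω : Set ι | e ∉ ω} :=
          measureReal_mono (fun ω hω => hω.2) (measure_ne_top _ _)
      _ = 0 := h0
  have hge : 0 ≤ (prodBernoulli w).real (B \ {ω : Set ι | e ∈ ω}) := measureReal_nonneg
  linarith

/-- **Forcing a coordinate = pulling back under `insert`.**  For every event `B`:
`μ_{w[e ↦ 1]}(B) = μ_w {ω | insert e ω ∈ B}`. [folklore] -/
theorem prodBernoulli_real_update_one (w : ι → unitInterval) (e : ι) (B : Set (Set ι)) :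
    (prodBernoulli (Function.update w e 1)).real B = (prodBernoulli w).real {ω | insert e ω ∈ B} := by
  set w' := Function.update w e 1 with hw'
  have he : w' e = 1 := by simp [hw']
  rw [prodBernoulli_real_eq_inter_mem w' e he B]
  have hset : B ∩ {ω : Set ι | e ∈ ω} = {ω | insert e ω ∈ B} ∩ {ω : Set ι | e ∈ ω} := by
    ext ω
    simp only [Set.mem_inter_iff, Set.mem_setOf_eq]
    constructor
    · rintro ⟨hB, heω⟩; exact ⟨by rwa [Set.insert_eq_of_mem heω], heω⟩
    · rintro ⟨hB, heω⟩; exact ⟨by rwa [Set.insert_eq_of_mem heω] at hB, heω⟩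
  rw [hset, ← prodBernoulli_real_eq_inter_mem w' e he]
  exact prodBernoulli_real_update_of_determinedBy w e 1 (determinedBy_preimage_insert B e)

/-- `E₃` under a forced coordinate = `E₃` of the pulled-back events. [folklore] -/
theorem sahiE3_update_one (w : ι → unitInterval) (e : ι) (A B C : Set (Set ι)) :
    sahiE3 (prodBernoulli (Function.update w e 1)) A B C =
      sahiE3 (prodBernoulli w) {ω | insert e ω ∈ A} {ω | insert e ω ∈ B} {ω | insert e ω ∈ C} := by
  simp only [sahiE3_def, prodBernoulli_real_update_one]
  rfl

end Weights

/-! ### Reachability after forcing the pair `s(c,y)` open -/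

section Graph

variable {V : Type*}

/-- The open graph of `insert s(c,y) ω` is the open graph of `ω` with the edge `c y` added. [folklore] -/
theorem openGraph_insert (ω : BondConfig V) (c y : V) :
    openGraph (insert s(c, y) ω) = openGraph ω ⊔ SimpleGraph.edge c y := by
  rw [openGraph, openGraph, SimpleGraph.edge, Set.insert_eq, SimpleGraph.fromEdgeSet_union, sup_comm]

/-- Reachability after adding one edge (both directions; the tree has the forward implication
`reachable_sup_edge_imp`). [folklore] -/
theorem reachable_sup_edge_iff' (H : SimpleGraph V) (u v x z : V) :
    (H ⊔ SimpleGraph.edge u v).Reachable x z ↔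
      H.Reachable x z ∨ (H.Reachable x u ∧ H.Reachable v z) ∨ (H.Reachable x v ∧ H.Reachable u z) := by
  constructor
  · exact reachable_sup_edge_imp H u v
  · have mono : ∀ {s t : V}, H.Reachable s t → (H ⊔ SimpleGraph.edge u v).Reachable s t :=
      fun h => h.mono le_sup_left
    rintro (h | ⟨h1, h2⟩ | ⟨h1, h2⟩)
    · exact mono h
    · by_cases huv : u = v
      · subst huv; exact (mono h1).trans (mono h2)
      · have hadj : (H ⊔ SimpleGraph.edge u v).Adj u v := by
          rw [SimpleGraph.sup_adj, SimpleGraph.edge_adj]; exact Or.inr ⟨Or.inl ⟨rfl, rfl⟩, huv⟩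
        exact ((mono h1).trans hadj.reachable).trans (mono h2)
    · by_cases huv : u = v
      · subst huv; exact (mono h1).trans (mono h2)
      · have hadj : (H ⊔ SimpleGraph.edge u v).Adj v u := by
          rw [SimpleGraph.sup_adj, SimpleGraph.edge_adj]; exact Or.inr ⟨Or.inr ⟨rfl, rfl⟩, Ne.symm huv⟩
        exact ((mono h1).trans hadj.reachable).trans (mono h2)

/-- Open connection after forcing the pair `{c,y}`: `x ↔ z` in `insert s(c,y) ω` iff in `ω` either `x ↔ z`, or
`x ↔ c` and `y ↔ z`, or `x ↔ y` and `c ↔ z`. [folklore] -/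
theorem mem_openConn_insert_iff (ω : BondConfig V) (c y x z : V) :
    insert s(c, y) ω ∈ openConn x z ↔
      ω ∈ openConn x z ∨ (ω ∈ openConn x c ∧ ω ∈ openConn y z) ∨ (ω ∈ openConn x y ∧ ω ∈ openConn c z) := by
  change (openGraph (insert s(c, y) ω)).Reachable x z ↔ _
  rw [openGraph_insert]
  exact reachable_sup_edge_iff' (openGraph ω) c y x z

end Graph

/-! ### `T_inc` on the glued graph is `β` -/

section Beta

variable {V : Type} [Fintype V] [DecidableEq V]

omit [Fintype V] [DecidableEq V] in
/-- Pull-back of `N_a = {a↔b} ∪ {a↔c}` under gluing `{c,y}`: it is `lnk[a | {b,c,y}]`. [folklore] -/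
theorem preimage_insert_nonIsol_a (a b c y : V) :
    {ω : BondConfig V | insert s(c, y) ω ∈ (openConn a b ∪ openConn a c : Set (BondConfig V))} =
      {ω : BondConfig V | ∃ x ∈ ({a} : Set V), ∃ z ∈ ({b, c, y} : Set V), (openGraph ω).Reachable x z} := by
  ext ω
  have r := fun u v => mem_openConn_insert_iff ω c y u v
  simp only [Set.mem_setOf_eq, Set.mem_union, r, Set.mem_singleton_iff, exists_eq_left, Set.mem_insert_iff,
    exists_eq_or_imp]
  have t : ∀ {u v s : V}, ω ∈ openConn u v → ω ∈ openConn v s → ω ∈ openConn u s :=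
    fun h1 h2 => SimpleGraph.Reachable.trans h1 h2
  have sy : ∀ {u v : V}, ω ∈ openConn u v → ω ∈ openConn v u := fun h => SimpleGraph.Reachable.symm h
  have rc : ω ∈ openConn c c := SimpleGraph.Reachable.refl _
  change _ ↔ (openGraph ω).Reachable a b ∨ (openGraph ω).Reachable a c ∨ (openGraph ω).Reachable a y
  change (ω ∈ openConn a b ∨ _ ∨ _) ∨ (ω ∈ openConn a c ∨ _ ∨ _) ↔ ω ∈ openConn a b ∨ ω ∈ openConn a c ∨ ω ∈ openConn a y
  tauto

omit [Fintype V] [DecidableEq V] in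
/-- Pull-back of `N_b = {a↔b} ∪ {b↔c}` under gluing `{c,y}`: it is `lnk[{a,c,y} | b]`. [folklore] -/
theorem preimage_insert_nonIsol_b (a b c y : V) :
    {ω : BondConfig V | insert s(c, y) ω ∈ (openConn a b ∪ openConn b c : Set (BondConfig V))} =
      {ω : BondConfig V | ∃ x ∈ ({a, c, y} : Set V), ∃ z ∈ ({b} : Set V), (openGraph ω).Reachable x z} := by
  ext ω
  have r := fun u v => mem_openConn_insert_iff ω c y u v
  simp only [Set.mem_setOf_eq, Set.mem_union, r, Set.mem_singleton_iff, exists_eq_left, Set.mem_insert_iff,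
    exists_eq_or_imp]
  have t : ∀ {u v s : V}, ω ∈ openConn u v → ω ∈ openConn v s → ω ∈ openConn u s :=
    fun h1 h2 => SimpleGraph.Reachable.trans h1 h2
  have sy : ∀ {u v : V}, ω ∈ openConn u v → ω ∈ openConn v u := fun h => SimpleGraph.Reachable.symm h
  have rc : ω ∈ openConn c c := SimpleGraph.Reachable.refl _
  change (ω ∈ openConn a b ∨ _ ∨ _) ∨ (ω ∈ openConn b c ∨ _ ∨ _) ↔
    (openGraph ω).Reachable a b ∨ (openGraph ω).Reachable c b ∨ (openGraph ω).Reachable y b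
  change _ ↔ ω ∈ openConn a b ∨ ω ∈ openConn c b ∨ ω ∈ openConn y b
  tauto

omit [Fintype V] [DecidableEq V] in
/-- Pull-back of `N_c = {a↔c} ∪ {b↔c}` under gluing `{c,y}`: it is `lnk[{a,b} | {c,y}]`. [folklore] -/
theorem preimage_insert_nonIsol_c (a b c y : V) :
    {ω : BondConfig V | insert s(c, y) ω ∈ (openConn a c ∪ openConn b c : Set (BondConfig V))} =
      {ω : BondConfig V | ∃ x ∈ ({a, b} : Set V), ∃ z ∈ ({c, y} : Set V), (openGraph ω).Reachable x z} := by
  ext ω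
  have r := fun u v => mem_openConn_insert_iff ω c y u v
  simp only [Set.mem_setOf_eq, Set.mem_union, r, Set.mem_singleton_iff, exists_eq_left, Set.mem_insert_iff,
    exists_eq_or_imp]
  have t : ∀ {u v s : V}, ω ∈ openConn u v → ω ∈ openConn v s → ω ∈ openConn u s :=
    fun h1 h2 => SimpleGraph.Reachable.trans h1 h2
  have sy : ∀ {u v : V}, ω ∈ openConn u v → ω ∈ openConn v u := fun h => SimpleGraph.Reachable.symm h
  have rc : ω ∈ openConn c c := SimpleGraph.Reachable.refl _
  change (ω ∈ openConn a c ∨ _ ∨ _) ∨ (ω ∈ openConn b c ∨ _ ∨ _) ↔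
    ((openGraph ω).Reachable a c ∨ (openGraph ω).Reachable a y) ∨
      ((openGraph ω).Reachable b c ∨ (openGraph ω).Reachable b y)
  change _ ↔ (ω ∈ openConn a c ∨ ω ∈ openConn a y) ∨ (ω ∈ openConn b c ∨ ω ∈ openConn b y)
  tauto

/-- **`TIncRow → BetaRow`.**  The harness row `β = E₃(lnk[a|bcy], lnk[ab|cy], lnk[acy|b])` on a weighted graph is the
three-terminal row `T_inc` on the same graph with the pair `{c,y}` forced open (weight one), read back through
`insert s(c,y)`; so a proof of `T_inc` for all finite weighted graphs proves `β` (and, by the same device, `r5`).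
[folklore] -/
theorem betaRow_of_tIncRow (h : TIncRow) : BetaRow := by
  intro V _ w a b c y
  classical
  have key := h V (Function.update w s(c, y) 1) a b c
  rw [sahiE3_update_one, preimage_insert_nonIsol_a, preimage_insert_nonIsol_b, preimage_insert_nonIsol_c,
    sahiE3_comm₂₃] at key
  exact key

end Beta

end CoSunflowerGlue

end Summit.CriticalPhenomena.PercolationContinuityZ3.Theorems

end
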